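import Mathlib.Analysis.Convex.Contractible
import Mathlib.AlgebraicTopology.FundamentalGroupoid.SimplyConnected
import Mathlib.Topology.Connected.LocallyPathConnected
import Literature.Topology.FourManifolds.SphereHypersurfaceSides
import Literature.Topology.FourManifolds.SchoenfliesFlat
import HarnessLib

/-!
# The open sides of a smoothly embedded codimension-one sphere in a sphere are open cells

Topic `Literature/Topology/FourManifolds` (addendum to `SphereHypersurfaceSides.lean`, same
namespace `Literature.Topology.FourManifolds.SphereHypersurfaceSides.TubeData`).  **Everything in
this file is proved; no definition, no notation and no named fact is introduced.**  (Below,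
`𝔼 n = EuclideanSpace ℝ (Fin n)` and `𝕊 n` is the unit sphere of `𝔼 (n+1)`; both are written
out in full in the code.)

For a smooth embedding `f : 𝕊 m → 𝕊 (m+1)`, `m ≥ 1`, with tube data `D : TubeData f` and side
function `g = D.sideFun` (`SphereHypersurfaceSides.lean`, §4: `g⁻¹(0) = f(𝕊 m)`, the open sides
`{g > 0}`, `{g < 0}` are the two complementary components of the hypersurface), the closed sides
`{g ≥ 0}`, `{g ≤ 0}` are `(m+1)`-cells by Brown's generalized Schoenflies theorem
(`TubeData.nonempty_homeomorph_setOf_sideFun_nonneg/nonpos`, Daverman Thm. II.6.6).  This file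
records the consequences for the *open* sides that covering-space arguments over one side need
(the lifting criterion asks for a simply connected, locally path connected base):

* `TubeData.nonempty_homeomorph_setOf_sideFun_pos_ball` / `…_neg_ball` (**the open sides are
  open `(m+1)`-cells**): `{g > 0} ≃ₜ Bᵐ⁺¹`, `{g < 0} ≃ₜ Bᵐ⁺¹` (open unit ball of `𝔼 (m+1)`);
* `TubeData.simplyConnectedSpace_setOf_sideFun_pos` / `…_neg`: the open sides are simply
  connected;
* `TubeData.locallyPathConnectedSpace_setOf_sideFun_pos` / `…_neg`: the open sides are locally
  path connected.

## Proofs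

Let `Φ : {g ≥ 0} ≃ₜ B̄ᵐ⁺¹` be a cell homeomorphism (Brown).  By the *pair statement* of
`SchoenfliesFlat.lean` (§2, `IsTopSphere.norm_eq_one_iff`, invariance of domain: a
homeomorphism of a subset `D` of a topological sphere `S` onto `B̄ⁿ` carries exactly `Z` onto
`∂B̄ⁿ` as soon as `D ∖ Z` is open and `Z ⊆ closure (S ∖ D)`), applied to `D = {g ≥ 0}`,
`Z = {g = 0}` — here `D ∖ Z = {g > 0}` is open (`g` is smooth, `TubeData.contMDiff_sideFun`)
and `Z ⊆ {g ≤ 0} = closure {g < 0}` (`TubeData.closure_setOf_sideFun_neg`) — `Φ` carries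
`{g = 0}` onto the unit sphere (`norm_eq_one_iff_of_homeomorph_setOf_sideFun_nonneg`), hence
restricts to a homeomorphism `{g > 0} ≃ₜ Bᵐ⁺¹` (§1,
`nonempty_homeomorph_ball_of_mem_iff_norm_lt_one`).  The open ball is convex and nonempty, hence
contractible (Mathlib `Convex.contractibleSpace`), hence simply connected, and simple
connectivity is transported along the homeomorphism
(`ContinuousMap.HomotopyEquiv.simplyConnectedSpace`; Hatcher, Prop. 1.18).  Local path
connectedness: `{g > 0}` is an open subset of the manifold `𝕊 (m+1)`
(`ChartedSpace.locallyPathConnectedSpace`, `IsOpen.locallyPathConnectedSpace`).  The side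
`{g < 0}` is treated symmetrically (`nonempty_homeomorph_setOf_sideFun_nonpos`,
`closure_setOf_sideFun_pos`).

## References

* R. J. Daverman, *Decompositions of manifolds*, Pure and Applied Mathematics 124, Academic Press
  (1986), §II.6, Thm. 6 and its proof (PDF p. 40 of the held copy
  `book:daverman1986-decompositions-manifolds`). [Daverman1986]
* A. Hatcher, *Algebraic Topology*, Cambridge University Press (2002), Ch. 1, §1.1 (simply
  connected spaces; `π₁` is an invariant of homotopy equivalence, Prop. 1.18, so contractible
  spaces are simply connected). [HatcherAT2002]
-/

open Set Function Metric Module Filter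
open scoped Manifold ContDiff Topology

noncomputable section

namespace Literature.Topology.FourManifolds

/-! ### §1 Restricting a cell homeomorphism to the open cell -/

section Restrict

variable {n : ℕ} {S : Type*} [TopologicalSpace S]

/-- **Restriction of a cell homeomorphism to the open cell.**  Let `Φ : D ≃ₜ B̄ⁿ` be a
homeomorphism of a subset `D` of a space `S` onto the closed unit ball, and let `U ⊆ D` consist
exactly of the points of `D` sent into the open unit ball.  Then `Φ` restricts to a homeomorphism
`U ≃ₜ Bⁿ` onto the open unit ball. [folklore] -/
theorem nonempty_homeomorph_ball_of_mem_iff_norm_lt_one {D U : Set S}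
    (Φ : D ≃ₜ closedBall (0 : EuclideanSpace ℝ (Fin n)) 1) (hUD : U ⊆ D)
    (hU : ∀ z : D, (z : S) ∈ U ↔ ‖(Φ z : EuclideanSpace ℝ (Fin n))‖ < 1) :
    Nonempty (U ≃ₜ ball (0 : EuclideanSpace ℝ (Fin n)) 1) := by
  have hinv : ∀ u : ball (0 : EuclideanSpace ℝ (Fin n)) 1,
      ((Φ.symm ⟨u, ball_subset_closedBall u.2⟩ : D) : S) ∈ U := fun u => by
    rw [hU, Φ.apply_symm_apply]
    exact mem_ball_zero_iff.1 u.2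
  refine ⟨{ toFun := fun z => ⟨Φ ⟨z, hUD z.2⟩, mem_ball_zero_iff.2 ((hU ⟨z, hUD z.2⟩).1 z.2)⟩
            invFun := fun u => ⟨Φ.symm ⟨u, ball_subset_closedBall u.2⟩, hinv u⟩
            left_inv := fun z => Subtype.ext (by simp)
            right_inv := fun u => Subtype.ext (by simp)
            continuous_toFun := ?_
            continuous_invFun := ?_ }⟩
  · exact (continuous_subtype_val.comp
      (Φ.continuous.comp (continuous_subtype_val.subtype_mk _))).subtype_mk _
  · exact (continuous_subtype_val.comp
      (Φ.symm.continuous.comp (continuous_subtype_val.subtype_mk _))).subtype_mk _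

end Restrict

namespace SphereHypersurfaceSides

namespace TubeData

/-! ### §2 The open sides are open cells -/

variable {m : ℕ}
  {f : sphere (0 : EuclideanSpace ℝ (Fin (m + 1))) 1 →
    sphere (0 : EuclideanSpace ℝ (Fin (m + 1 + 1))) 1}
  (D : TubeData f) (hm : 1 ≤ m)
include hm

/-- **The cell `{g ≥ 0} ≃ₜ B̄ᵐ⁺¹` as a pair**: every homeomorphism of the closed side `{g ≥ 0}`
onto the closed unit ball carries exactly the hypersurface `{g = 0} = f(𝕊 m)` onto the unit
sphere (invariance of domain, `IsTopSphere.norm_eq_one_iff`). [folklore] -/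
theorem norm_eq_one_iff_of_homeomorph_setOf_sideFun_nonneg
    (Φ : {z | 0 ≤ D.sideFun z} ≃ₜ closedBall (0 : EuclideanSpace ℝ (Fin (m + 1))) 1)
    (z : {z | 0 ≤ D.sideFun z}) :
    ‖(Φ z : EuclideanSpace ℝ (Fin (m + 1)))‖ = 1 ↔ D.sideFun z = 0 := by
  haveI := Fact.mk (@finrank_euclideanSpace_fin ℝ _ (m + 1 + 1))
  have hS : IsTopSphere (m + 1) (sphere (0 : EuclideanSpace ℝ (Fin (m + 1 + 1))) 1) :=
    isTopSphere_sphere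
  have hcont : Continuous D.sideFun := (D.contMDiff_sideFun hm).continuous
  have hopen : IsOpen ({z | 0 ≤ D.sideFun z} \ {z | D.sideFun z = 0}) := by
    have : {z | 0 ≤ D.sideFun z} \ {z | D.sideFun z = 0} = {z | 0 < D.sideFun z} := by
      ext z
      simp only [Set.mem_sdiff, mem_setOf_eq]
      exact ⟨fun h => lt_of_le_of_ne h.1 (Ne.symm h.2), fun h => ⟨h.le, h.ne'⟩⟩
    rw [this]
    exact isOpen_lt continuous_const hcont
  have hcl : {z | D.sideFun z = 0} ⊆ closure {z | 0 ≤ D.sideFun z}ᶜ := by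
    have : {z | 0 ≤ D.sideFun z}ᶜ = {z | D.sideFun z < 0} := by
      ext z
      simp only [mem_compl_iff, mem_setOf_eq, not_le]
    rw [this, D.closure_setOf_sideFun_neg hm]
    exact fun z hz => le_of_eq hz
  exact hS.norm_eq_one_iff hopen hcl Φ z

/-- **The cell `{g ≤ 0} ≃ₜ B̄ᵐ⁺¹` as a pair**: every homeomorphism of the closed side `{g ≤ 0}`
onto the closed unit ball carries exactly the hypersurface `{g = 0} = f(𝕊 m)` onto the unit
sphere. [folklore] -/
theorem norm_eq_one_iff_of_homeomorph_setOf_sideFun_nonpos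
    (Φ : {z | D.sideFun z ≤ 0} ≃ₜ closedBall (0 : EuclideanSpace ℝ (Fin (m + 1))) 1)
    (z : {z | D.sideFun z ≤ 0}) :
    ‖(Φ z : EuclideanSpace ℝ (Fin (m + 1)))‖ = 1 ↔ D.sideFun z = 0 := by
  haveI := Fact.mk (@finrank_euclideanSpace_fin ℝ _ (m + 1 + 1))
  have hS : IsTopSphere (m + 1) (sphere (0 : EuclideanSpace ℝ (Fin (m + 1 + 1))) 1) :=
    isTopSphere_sphere
  have hcont : Continuous D.sideFun := (D.contMDiff_sideFun hm).continuous
  have hopen : IsOpen ({z | D.sideFun z ≤ 0} \ {z | D.sideFun z = 0}) := by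
    have : {z | D.sideFun z ≤ 0} \ {z | D.sideFun z = 0} = {z | D.sideFun z < 0} := by
      ext z
      simp only [Set.mem_sdiff, mem_setOf_eq]
      exact ⟨fun h => lt_of_le_of_ne h.1 h.2, fun h => ⟨h.le, h.ne⟩⟩
    rw [this]
    exact isOpen_lt hcont continuous_const
  have hcl : {z | D.sideFun z = 0} ⊆ closure {z | D.sideFun z ≤ 0}ᶜ := by
    have : {z | D.sideFun z ≤ 0}ᶜ = {z | 0 < D.sideFun z} := by
      ext z
      simp only [mem_compl_iff, mem_setOf_eq, not_le]
    rw [this, D.closure_setOf_sideFun_pos hm]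
    exact fun z hz => le_of_eq hz.symm
  exact hS.norm_eq_one_iff hopen hcl Φ z

/-- **The open side `{g > 0}` is an open `(m+1)`-cell** (Brown's theorem, open form).
[cite: Daverman1986, Thm. II.6.6 (PDF p. 40)] -/
theorem nonempty_homeomorph_setOf_sideFun_pos_ball :
    Nonempty ({z | 0 < D.sideFun z} ≃ₜ Metric.ball (0 : EuclideanSpace ℝ (Fin (m + 1))) 1) := by
  obtain ⟨Φ⟩ := D.nonempty_homeomorph_setOf_sideFun_nonneg hm
  refine nonempty_homeomorph_ball_of_mem_iff_norm_lt_one Φ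
    (fun z (hz : 0 < D.sideFun z) => show 0 ≤ D.sideFun z from hz.le) fun z => ?_
  have hle : ‖(Φ z : EuclideanSpace ℝ (Fin (m + 1)))‖ ≤ 1 := mem_closedBall_zero_iff.1 (Φ z).2
  rw [mem_setOf_eq, hle.lt_iff_ne, Ne,
    D.norm_eq_one_iff_of_homeomorph_setOf_sideFun_nonneg hm Φ z]
  exact ⟨fun h => h.ne', fun h => lt_of_le_of_ne z.2 (Ne.symm h)⟩

/-- **The open side `{g < 0}` is an open `(m+1)`-cell** (Brown's theorem, open form).
[cite: Daverman1986, Thm. II.6.6 (PDF p. 40)] -/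
theorem nonempty_homeomorph_setOf_sideFun_neg_ball :
    Nonempty ({z | D.sideFun z < 0} ≃ₜ Metric.ball (0 : EuclideanSpace ℝ (Fin (m + 1))) 1) := by
  obtain ⟨Φ⟩ := D.nonempty_homeomorph_setOf_sideFun_nonpos hm
  refine nonempty_homeomorph_ball_of_mem_iff_norm_lt_one Φ
    (fun z (hz : D.sideFun z < 0) => show D.sideFun z ≤ 0 from hz.le) fun z => ?_
  have hle : ‖(Φ z : EuclideanSpace ℝ (Fin (m + 1)))‖ ≤ 1 := mem_closedBall_zero_iff.1 (Φ z).2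
  rw [mem_setOf_eq, hle.lt_iff_ne, Ne,
    D.norm_eq_one_iff_of_homeomorph_setOf_sideFun_nonpos hm Φ z]
  exact ⟨fun h => h.ne, fun h => lt_of_le_of_ne z.2 h⟩

/-! ### §3 The open sides are simply connected and locally path connected -/

/-- **The open side `{g > 0}` is simply connected.** [folklore] -/
theorem simplyConnectedSpace_setOf_sideFun_pos : SimplyConnectedSpace {z | 0 < D.sideFun z} := by
  obtain ⟨Ψ⟩ := D.nonempty_homeomorph_setOf_sideFun_pos_ball hm
  haveI : ContractibleSpace (ball (0 : EuclideanSpace ℝ (Fin (m + 1))) 1) :=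
    (convex_ball (0 : EuclideanSpace ℝ (Fin (m + 1))) 1).contractibleSpace
      (nonempty_ball.2 one_pos)
  exact Ψ.toHomotopyEquiv.simplyConnectedSpace

/-- **The open side `{g < 0}` is simply connected.** [folklore] -/
theorem simplyConnectedSpace_setOf_sideFun_neg : SimplyConnectedSpace {z | D.sideFun z < 0} := by
  obtain ⟨Ψ⟩ := D.nonempty_homeomorph_setOf_sideFun_neg_ball hm
  haveI : ContractibleSpace (ball (0 : EuclideanSpace ℝ (Fin (m + 1))) 1) :=
    (convex_ball (0 : EuclideanSpace ℝ (Fin (m + 1))) 1).contractibleSpace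
      (nonempty_ball.2 one_pos)
  exact Ψ.toHomotopyEquiv.simplyConnectedSpace

/-- **The open side `{g > 0}` is locally path connected.** [folklore] -/
theorem locallyPathConnectedSpace_setOf_sideFun_pos :
    LocallyPathConnectedSpace {z | 0 < D.sideFun z} := by
  haveI := Fact.mk (@finrank_euclideanSpace_fin ℝ _ (m + 1 + 1))
  haveI : LocallyPathConnectedSpace (sphere (0 : EuclideanSpace ℝ (Fin (m + 1 + 1))) 1) :=
    ChartedSpace.locallyPathConnectedSpace (EuclideanSpace ℝ (Fin (m + 1)))
      (sphere (0 : EuclideanSpace ℝ (Fin (m + 1 + 1))) 1)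
  exact (isOpen_lt continuous_const (D.contMDiff_sideFun hm).continuous).locallyPathConnectedSpace

/-- **The open side `{g < 0}` is locally path connected.** [folklore] -/
theorem locallyPathConnectedSpace_setOf_sideFun_neg :
    LocallyPathConnectedSpace {z | D.sideFun z < 0} := by
  haveI := Fact.mk (@finrank_euclideanSpace_fin ℝ _ (m + 1 + 1))
  haveI : LocallyPathConnectedSpace (sphere (0 : EuclideanSpace ℝ (Fin (m + 1 + 1))) 1) :=
    ChartedSpace.locallyPathConnectedSpace (EuclideanSpace ℝ (Fin (m + 1)))
      (sphere (0 : EuclideanSpace ℝ (Fin (m + 1 + 1))) 1)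
  exact (isOpen_lt (D.contMDiff_sideFun hm).continuous continuous_const).locallyPathConnectedSpace

end TubeData

end SphereHypersurfaceSides

end Literature.Topology.FourManifolds

end
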